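import Summits.QuantumFields.QCD.Theorems.GaussianLinkFramesFrameFMClosurePlacementSidesAux3

/-!
# Crux `GaussianLinkFrames.FrameFMClosure` (stmt-QuantumFields-17375), line `pad-the-fibre`, stub
`stub_placementSides` — helper 4: the balanced canonical placement for the BALL-COMPLEMENT side `A = (ball S z r)ᶜ`

The complement of the odd ball has, in every coordinate, an EVEN complementary arc `C = [z+r+1, z-r-1]` of
`2(S-r)` residues, perfectly paired by dominoes from its bottom `p = z + r + 1`.  The pairing used for this side is
the FIRST-OUTSIDE-COORDINATE FLIP: a site of `A` has a coordinate outside the ball; flip the first such coordinate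
along the domino pairing of `C` (helper 2, `first_coord_flip`).  It is a global nearest-neighbour involution of `A`,
so the two blocks need no alignment.  Per coordinate, every residue admits a pad position (with the far bottom layer
frozen only at the centre of a ball of radius `1`) whose refitted block meets `C` in a union of dominoes
(`ballc_coord_data`); hence each clipped block `P ∩ A` is stable (`ballc_block`) and helper 5's
`balanced_touched_of_blocks` balances the touched region (`ballc_balanced`).

References: elementary [folklore]; the pad recipe is the line card of `pad-the-fibre`.
-/

noncomputable section

open scoped BigOperators
open Literature.MathematicalPhysics.QuantumFieldTheory Literature.MathematicalPhysics.QuantumLattice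
  Literature.Probability.LatticeModels
open Summit.QuantumFields.QCD.Theorems.VonMisesCircles Summit.QuantumFields.QCD.Theorems.PadTheFibre

namespace Summit.QuantumFields.QCD.Theorems.PadTheFibreTwoStar

/-! ## §1 One coordinate of a ball-complement placement -/

/-- **Pad data in one coordinate of the ball complement.**  Offsets are read from the bottom `p` of the complementary
arc `C = [0, m-1]` (`m = N - 2r - 1 ≥ 2` even; the ball is `[m, N-1]`).  For every residue `c₀` there are a pad base
`B`, a flag `fz` (bottom layer frozen) and a window `[k₁, k₂] ⊆ [0, m-1]` (`k₁` even, `k₂` odd; possibly empty) with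
`c₀` in the core away from the frozen layer, such that a residue of `C` lies in the refitted block iff its offset lies
in the window, and the whole window lies in the block. [folklore] -/
theorem ballc_coord_data {N : ℕ} [NeZero N] (r m : ℕ) (hr : 1 ≤ r) (hm : m + 2 * r + 1 = N) (hm2 : 2 ≤ m)
    (hme : Even m) (p c₀ : ZMod N) :
    ∃ (B : ZMod N) (fz : Bool) (k₁ k₂ : ℕ),
      ((c₀ - B).val = 1 ∨ (c₀ - B).val = 2) ∧ (fz = true → (c₀ - B).val = 2) ∧
      Even k₁ ∧ Odd k₂ ∧ k₂ + 1 ≤ m ∧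
      ∀ u : ZMod N,
        (((u - B).val ≤ 3 ∧ (fz = true → (u - B).val ≠ 0)) ∧ (u - p).val ≤ m - 1 →
            k₁ ≤ (u - p).val ∧ (u - p).val ≤ k₂) ∧
        (k₁ ≤ (u - p).val ∧ (u - p).val ≤ k₂ → (u - B).val ≤ 3 ∧ (fz = true → (u - B).val ≠ 0)) := by
  set d := (c₀ - p).val with hd
  have hdN : d < N := ZMod.val_lt _
  obtain ⟨m', hm'⟩ := hme
  have h2N : ((2 : ℕ) : ZMod N) ≠ 0 := by
    intro h; rw [ZMod.natCast_eq_zero_iff] at h; have := Nat.le_of_dvd (by norm_num) h; omega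
  have hc2 : (c₀ - (c₀ - 2)).val = 2 := by
    rw [show c₀ - (c₀ - 2) = ((2 : ℕ) : ZMod N) by push_cast; ring, ZMod.val_cast_of_lt (by omega)]
  have hc1 : (c₀ - (c₀ - 1)).val = 1 := by
    rw [show c₀ - (c₀ - 1) = ((1 : ℕ) : ZMod N) by push_cast; ring, ZMod.val_cast_of_lt (by omega)]
  -- transfer to the pad base `c₀ - 2` resp. `c₀ - 1`
  have hB2 : 2 ≤ d → ∀ u : ZMod N, (u - (c₀ - 2)).val =
      if d - 2 ≤ (u - p).val then (u - p).val - (d - 2) else (u - p).val + N - (d - 2) := by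
    intro h2 u
    refine val_sub_transfer p (c₀ - 2) (d - 2) ?_ u
    rw [show c₀ - 2 - p = (c₀ - p) - ((2 : ℕ) : ZMod N) by push_cast; ring]
    exact val_sub_natCast_of_le _ 2 h2
  have hB1 : 1 ≤ d → ∀ u : ZMod N, (u - (c₀ - 1)).val =
      if d - 1 ≤ (u - p).val then (u - p).val - (d - 1) else (u - p).val + N - (d - 1) := by
    intro h1 u
    refine val_sub_transfer p (c₀ - 1) (d - 1) ?_ u
    rw [show c₀ - 1 - p = (c₀ - p) - ((1 : ℕ) : ZMod N) by push_cast; ring]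
    exact val_sub_natCast_of_le _ 1 h1
  have hB2' : d = 0 → ∀ u : ZMod N, (u - (c₀ - 2)).val =
      if N - 2 ≤ (u - p).val then (u - p).val - (N - 2) else (u - p).val + N - (N - 2) := by
    intro h0 u
    have hcp : c₀ = p := sub_eq_zero.1 ((ZMod.val_eq_zero _).1 (by rw [← hd]; exact h0))
    refine val_sub_transfer p (c₀ - 2) (N - 2) ?_ u
    rw [hcp, show p - 2 - p = -((2 : ℕ) : ZMod N) by push_cast; ring, ZMod.neg_val, if_neg h2N,
      ZMod.val_cast_of_lt (by omega)]
  have hB1' : d = N - 1 → ∀ u : ZMod N, (u - (c₀ - 1)).val =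
      if N - 2 ≤ (u - p).val then (u - p).val - (N - 2) else (u - p).val + N - (N - 2) := by
    intro h0 u
    refine val_sub_transfer p (c₀ - 1) (N - 2) ?_ u
    rw [show c₀ - 1 - p = (c₀ - p) - ((1 : ℕ) : ZMod N) by push_cast; ring, val_sub_natCast_of_le _ 1 (by omega)]
    omega
  by_cases hout : d ≤ m - 1
  · rcases Nat.even_or_odd d with ⟨k, hk⟩ | ⟨k, hk⟩
    · -- outside, even offset: pad `[d-2, d+1]`
      refine ⟨c₀ - 2, false, d - 2, d + 1, Or.inr hc2, by simp, ⟨k - 1, by omega⟩, ⟨k, by omega⟩, by omega,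
        fun u => ?_⟩
      have hul : (u - p).val < N := ZMod.val_lt _
      simp only [Bool.false_eq_true, false_implies, and_true]
      by_cases h2 : 2 ≤ d
      · have ht := hB2 h2 u
        constructor
        · rintro ⟨hs, htl⟩; rw [ht] at hs; split_ifs at hs with h <;> omega
        · rintro ⟨h1, h3⟩; rw [ht, if_pos (by omega)]; omega
      · have ht := hB2' (by omega) u
        constructor
        · rintro ⟨hs, htl⟩; rw [ht] at hs; split_ifs at hs with h <;> omega
        · rintro ⟨h1, h3⟩; rw [ht, if_neg (by omega)]; omega
    · -- outside, odd offset: pad `[d-1, d+2]`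
      refine ⟨c₀ - 1, false, d - 1, min (d + 2) (m - 1), Or.inl hc1, by simp, ⟨k, by omega⟩, ?_, by omega,
        fun u => ?_⟩
      · rcases le_total (d + 2) (m - 1) with h | h
        · rw [min_eq_left h]; exact ⟨k + 1, by omega⟩
        · rw [min_eq_right h]; exact ⟨m' - 1, by omega⟩
      · have hul : (u - p).val < N := ZMod.val_lt _
        have ht := hB1 (by omega) u
        simp only [Bool.false_eq_true, false_implies, and_true]
        constructor
        · rintro ⟨hs, htl⟩; rw [ht] at hs
          refine ⟨?_, le_min ?_ htl⟩ <;> split_ifs at hs with h <;> omega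
        · rintro ⟨h1, h3⟩; rw [ht, if_pos (by omega)]
          have := min_le_left (d + 2) (m - 1); omega
  · have hout' : m ≤ d := by omega
    clear hout
    by_cases hI1 : m ≤ d - 2 ∧ d + 1 ≤ N - 1
    · -- deep inside: pad `[d-2, d+1]` inside the ball, empty window
      refine ⟨c₀ - 2, false, 2, 1, Or.inr hc2, by simp, ⟨1, rfl⟩, ⟨0, rfl⟩, by omega, fun u => ⟨?_, ?_⟩⟩
      · rintro ⟨⟨hs, -⟩, htl⟩; rw [hB2 (by omega) u] at hs; split_ifs at hs with h <;> omega
      · rintro ⟨h1, h3⟩; omega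
    by_cases hI2 : m ≤ d - 1 ∧ d + 2 ≤ N - 1
    · -- deep inside: pad `[d-1, d+2]` inside the ball, empty window
      refine ⟨c₀ - 1, false, 2, 1, Or.inl hc1, by simp, ⟨1, rfl⟩, ⟨0, rfl⟩, by omega, fun u => ⟨?_, ?_⟩⟩
      · rintro ⟨⟨hs, -⟩, htl⟩; rw [hB1 (by omega) u] at hs; split_ifs at hs with h <;> omega
      · rintro ⟨h1, h3⟩; omega
    by_cases hI3 : d = N - 1
    · -- top of the ball: pad `[N-2, N+1]`, window `{0, 1}`
      refine ⟨c₀ - 1, false, 0, 1, Or.inl hc1, by simp, ⟨0, rfl⟩, ⟨0, rfl⟩, by omega, fun u => ?_⟩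
      have hul : (u - p).val < N := ZMod.val_lt _
      have ht := hB1' hI3 u
      simp only [Bool.false_eq_true, false_implies, and_true]
      constructor
      · rintro ⟨hs, htl⟩; rw [ht] at hs; split_ifs at hs with h <;> omega
      · rintro ⟨h1, h3⟩; rw [ht, if_neg (by omega)]; omega
    by_cases hI4 : d = m
    · -- bottom of the ball: pad `[m-2, m+1]`, window `{m-2, m-1}`
      refine ⟨c₀ - 2, false, m - 2, m - 1, Or.inr hc2, by simp, ⟨m' - 1, by omega⟩, ⟨m' - 1, by omega⟩, by omega,
        fun u => ?_⟩
      have hul : (u - p).val < N := ZMod.val_lt _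
      have ht := hB2 (by omega) u
      simp only [Bool.false_eq_true, false_implies, and_true]
      constructor
      · rintro ⟨hs, htl⟩; rw [ht] at hs; split_ifs at hs with h <;> omega
      · rintro ⟨h1, h3⟩; rw [ht, if_pos (by omega)]; omega
    · -- the centre of a ball of radius `1`: pad `[d-2, d+1]` with the bottom layer frozen, empty window
      have hd1 : d = m + 1 ∧ m + 3 = N := by omega
      refine ⟨c₀ - 2, true, 2, 1, Or.inr hc2, fun _ => hc2, ⟨1, rfl⟩, ⟨0, rfl⟩, by omega, fun u => ⟨?_, ?_⟩⟩
      · rintro ⟨⟨hs, hs0⟩, htl⟩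
        have ht := hB2 (by omega) u
        rw [ht] at hs hs0
        split_ifs at hs hs0 with h
        · have := hs0 rfl; omega
        · omega
      · rintro ⟨h1, h3⟩; omega

/-! ## §2 The block of one point and its stability under the first-outside-coordinate flip -/

/-- Chart of the ball from the bottom of the complementary arc: `y ∈ ball S z r` iff every offset from
`p i = z i + (r+1)` is at least `m = 2S - 2r`. [folklore] -/
theorem mem_ball_iff_val' {S : ℕ} (z y : TorusSite 4 (2 * S + 1)) (r : ℕ) (hr : r + 1 ≤ S) :
    y ∈ ball S z r ↔ ∀ i, 2 * S - 2 * r ≤ (y i - (z i + ((r + 1 : ℕ) : ZMod (2 * S + 1)))).val := by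
  haveI : NeZero (2 * S + 1) := ⟨by omega⟩
  rw [mem_ball_iff_val z y r (by omega)]
  have key : ∀ i, (y i - z i + (r : ZMod (2 * S + 1))).val ≤ 2 * r ↔
      2 * S - 2 * r ≤ (y i - (z i + ((r + 1 : ℕ) : ZMod (2 * S + 1)))).val := by
    intro i
    have e : y i - z i + (r : ZMod (2 * S + 1)) = y i - (z i - (r : ZMod (2 * S + 1))) := by ring
    have hd : (z i + ((r + 1 : ℕ) : ZMod (2 * S + 1)) - (z i - (r : ZMod (2 * S + 1)))).val = 2 * r + 1 := by
      rw [show z i + ((r + 1 : ℕ) : ZMod (2 * S + 1)) - (z i - (r : ZMod (2 * S + 1))) =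
        ((2 * r + 1 : ℕ) : ZMod (2 * S + 1)) by push_cast; ring, ZMod.val_cast_of_lt (by omega)]
    have ht := val_sub_transfer (z i - (r : ZMod (2 * S + 1))) _ (2 * r + 1) hd (y i)
    have hul : (y i - (z i - (r : ZMod (2 * S + 1)))).val < 2 * S + 1 := ZMod.val_lt _
    rw [e, ht]
    split_ifs with h <;> omega
  exact forall_congr' key

/-- **The block of a point for the ball-complement side** (`2 ≤ S`, `1 ≤ r`, `r + 1 ≤ S`).  For every `c` there are
a pad centre `x'` holding `c` in its core and frozen data `(M, cf)` such that the star of `c` lies in the interior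
`P = pad ∖ frozen`, and the FIRST-OUTSIDE-COORDINATE flip (flip the first coordinate lying outside the ball along the
domino pairing of the complementary arc from `p i = z i + (r+1)`) maps `P ∖ ball` into itself, is an involution there
and moves to a nearest neighbour. [folklore] -/
theorem ballc_block {S : ℕ} (hS : 2 ≤ S) (z : TorusSite 4 (2 * S + 1)) (r : ℕ) (hr₁ : 1 ≤ r) (hr₂ : r + 1 ≤ S)
    (c : TorusSite 4 (2 * S + 1)) :
    ∃ (x' : TorusSite 4 (2 * S + 1)) (M : Finset (Fin 4)) (cf : Fin 4 → ℤ), (∀ μ ∈ M, cf μ = -2 ∨ cf μ = 1) ∧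
      c ∈ ebox S x' 0 ∧
      (c ∈ ebox S x' 1 \ padFrozen S x' M cf ∧ ∀ μ : Fin 4, c + Pi.single μ 1 ∈ ebox S x' 1 \ padFrozen S x' M cf ∧
        c - Pi.single μ 1 ∈ ebox S x' 1 \ padFrozen S x' M cf) ∧
      let P : Fin 4 → ZMod (2 * S + 1) → Prop := fun j u =>
        (u - (z j + ((r + 1 : ℕ) : ZMod (2 * S + 1)))).val ≤ 2 * S - 2 * r - 1
      let π : Fin 4 → ZMod (2 * S + 1) → ZMod (2 * S + 1) := fun j u =>
        if Even (u - (z j + ((r + 1 : ℕ) : ZMod (2 * S + 1)))).val then u + 1 else u - 1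
      let σ : TorusSite 4 (2 * S + 1) → TorusSite 4 (2 * S + 1) := fun y =>
        if P 0 (y 0) then Function.update y 0 (π 0 (y 0)) else
        if P 1 (y 1) then Function.update y 1 (π 1 (y 1)) else
        if P 2 (y 2) then Function.update y 2 (π 2 (y 2)) else
        if P 3 (y 3) then Function.update y 3 (π 3 (y 3)) else y
      ∀ y ∈ ebox S x' 1 \ padFrozen S x' M cf, y ∉ ball S z r →
        σ y ∈ ebox S x' 1 \ padFrozen S x' M cf ∧ σ y ∉ ball S z r ∧ σ (σ y) = y ∧
          ∃ μ : Fin 4, σ y = y + Pi.single μ 1 ∨ y = σ y + Pi.single μ 1 := by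
  haveI : NeZero (2 * S + 1) := ⟨by omega⟩
  set m : ℕ := 2 * S - 2 * r with hm
  have hmN : m + 2 * r + 1 = 2 * S + 1 := by omega
  -- per-coordinate data
  have hdata := fun j : Fin 4 =>
    ballc_coord_data r m hr₁ hmN (by omega) ⟨S - r, by omega⟩ (z j + ((r + 1 : ℕ) : ZMod (2 * S + 1))) (c j)
  choose B fz k₁ k₂ hcore hfz hk₁ hk₂ hk₂m hwin using hdata
  set x' : TorusSite 4 (2 * S + 1) := fun j => B j + 2 with hx'
  set M : Finset (Fin 4) := Finset.univ.filter fun j => fz j = true with hM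
  set cf : Fin 4 → ℤ := fun _ => -2 with hcf
  have hoff : ∀ (y : TorusSite 4 (2 * S + 1)) j, y j - x' j + 2 = y j - B j := fun y j => by
    simp only [hx']; ring
  have hMj : ∀ j, j ∈ M ↔ fz j = true := fun j => by simp [hM]
  have hP : ∀ y : TorusSite 4 (2 * S + 1), y ∈ ebox S x' 1 \ padFrozen S x' M cf ↔
      ∀ j, (y j - B j).val ≤ 3 ∧ (fz j = true → (y j - B j).val ≠ 0) := by
    intro y
    rw [mem_interior_iff_val hS x' y M cf]
    simp only [hoff, hMj, hcf]
    constructor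
    · rintro ⟨h1, h2⟩ j
      exact ⟨h1 j, fun hj h0 => by have := h2 j hj; rw [h0] at this; norm_num at this⟩
    · intro h
      exact ⟨fun j => (h j).1, fun j hj h0 => (h j).2 hj (by exact_mod_cast (by omega : ((y j - B j).val) = 0))⟩
  refine ⟨x', M, cf, fun μ _ => Or.inl rfl, ?_, ?_, ?_⟩
  · rw [mem_core_iff_val (by omega) x' c]
    intro j
    have h1 : 1 ≤ (c j - B j).val := by rcases hcore j with h | h <;> omega
    rw [show c j - x' j + 1 = (c j - B j) - 1 by simp only [hx']; ring, val_sub_one_of_le _ h1]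
    rcases hcore j with h | h <;> omega
  · refine star_subset_interior hS x' c M cf (fun μ _ => Or.inl rfl) (fun j => by rw [hoff]; exact hcore j)
      (fun μ hμ => ⟨fun _ => by rw [hoff]; exact hfz μ ((hMj μ).1 hμ), fun h => by norm_num [hcf] at h⟩)
  · intro P π σ y hy hyA
    set p : Fin 4 → ZMod (2 * S + 1) := fun j => z j + ((r + 1 : ℕ) : ZMod (2 * S + 1)) with hp
    have hball : ∀ w : TorusSite 4 (2 * S + 1), w ∉ ball S z r ↔ ∃ j, P j (w j) := by
      intro w
      rw [mem_ball_iff_val' z w r hr₂]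
      simp only [P, not_forall, not_le]
      exact exists_congr fun j => by omega
    have hπ : ∀ j u, P j u → P j (π j u) ∧ π j (π j u) = u ∧ (π j u = u + 1 ∨ u = π j u + 1) := by
      intro j u hu
      have F := flip_window (p j) 0 (m - 1) ⟨0, rfl⟩ ⟨S - r - 1, by omega⟩ (by omega) u (Nat.zero_le _) hu
      exact ⟨F.2.1, F.2.2.1, F.2.2.2.1⟩
    obtain ⟨j, hj, -, hσy, hinv, hnn⟩ := first_coord_flip P π hπ y ((hball y).1 hyA)
    have hyP := (hP y).1 hy
    obtain ⟨hw1, hw2⟩ := (hwin j (y j)).1 ⟨hyP j, hj⟩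
    have F := flip_window (p j) (k₁ j) (k₂ j) (hk₁ j) (hk₂ j) (by have := hk₂m j; omega) (y j) hw1 hw2
    obtain ⟨hF1, hF2, -, -, -⟩ := F
    have hσy' : σ y = Function.update y j (π j (y j)) := hσy
    have hσj : σ y j = π j (y j) := by rw [hσy', Function.update_self]
    have hσi : ∀ i, i ≠ j → σ y i = y i := fun i hi => by rw [hσy', Function.update_of_ne hi]
    refine ⟨?_, ?_, hinv, j, hnn⟩
    · rw [hP]
      intro i
      by_cases hi : i = j
      · subst hi; rw [hσj]; exact (hwin i _).2 ⟨hF1, hF2⟩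
      · rw [hσi i hi]; exact hyP i
    · rw [hball]
      exact ⟨j, by rw [hσj]; exact (hπ j _ hj).1⟩

/-! ## §3 The balanced placement for the ball-complement side -/

open Classical in
/-- **Balanced canonical placement for the ball-complement side** (`2 ≤ S`, `1 ≤ r`, `r + 1 ≤ S`): for
`a, b ∉ ball S z r` there are pads holding `a`, `b` in their cores and canonical pad regions `Q₁, Q₂` about them
(forced links, `⊆ padLinks`) such that the touched region of `star(a) ∪ star(b) ∪ Q₁ ∪ Q₂` inside `(ball S z r)ᶜ` is
bipartite-balanced (no membership hypothesis on `a, b` is needed for the construction). [folklore] -/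
theorem ballc_balanced {S : ℕ} (hS : 2 ≤ S) (z : TorusSite 4 (2 * S + 1)) (r : ℕ) (hr₁ : 1 ≤ r) (hr₂ : r + 1 ≤ S)
    (a b : TorusSite 4 (2 * S + 1)) :
    ∃ (x' y' : TorusSite 4 (2 * S + 1)) (Q₁ Q₂ : Finset (Edge 4 (2 * S + 1))),
      a ∈ ebox S x' 0 ∧ b ∈ ebox S y' 0 ∧ IsPadRegion S x' Q₁ ∧ IsPadRegion S y' Q₂ ∧
      Q₁ ⊆ padLinks S x' ∧ Q₂ ⊆ padLinks S y' ∧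
      Balanced (touched S (ball S z r)ᶜ (starLinks S a ∪ starLinks S b ∪ Q₁ ∪ Q₂)) := by
  obtain ⟨x', M₁, c₁, hc₁, hax, hast, hσ₁⟩ := ballc_block hS z r hr₁ hr₂ a
  obtain ⟨y', M₂, c₂, hc₂, hby, hbst, hσ₂⟩ := ballc_block hS z r hr₁ hr₂ b
  simp only at hσ₁ hσ₂
  set σ : TorusSite 4 (2 * S + 1) → TorusSite 4 (2 * S + 1) := fun y =>
    if ((y 0 - (z 0 + ((r + 1 : ℕ) : ZMod (2 * S + 1)))).val ≤ 2 * S - 2 * r - 1) then Function.update y 0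
      (if Even (y 0 - (z 0 + ((r + 1 : ℕ) : ZMod (2 * S + 1)))).val then y 0 + 1 else y 0 - 1) else
    if ((y 1 - (z 1 + ((r + 1 : ℕ) : ZMod (2 * S + 1)))).val ≤ 2 * S - 2 * r - 1) then Function.update y 1
      (if Even (y 1 - (z 1 + ((r + 1 : ℕ) : ZMod (2 * S + 1)))).val then y 1 + 1 else y 1 - 1) else
    if ((y 2 - (z 2 + ((r + 1 : ℕ) : ZMod (2 * S + 1)))).val ≤ 2 * S - 2 * r - 1) then Function.update y 2
      (if Even (y 2 - (z 2 + ((r + 1 : ℕ) : ZMod (2 * S + 1)))).val then y 2 + 1 else y 2 - 1) else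
    if ((y 3 - (z 3 + ((r + 1 : ℕ) : ZMod (2 * S + 1)))).val ≤ 2 * S - 2 * r - 1) then Function.update y 3
      (if Even (y 3 - (z 3 + ((r + 1 : ℕ) : ZMod (2 * S + 1)))).val then y 3 + 1 else y 3 - 1) else y
    with hσ
  set P₁ := ebox S x' 1 \ padFrozen S x' M₁ c₁ with hP₁
  set P₂ := ebox S y' 1 \ padFrozen S y' M₂ c₂ with hP₂
  set Q₁ := (padLinks S x').filter fun e : Edge 4 (2 * S + 1) =>
    e.1 ∉ padFrozen S x' M₁ c₁ ∧ e.1.shift e.2 ∉ padFrozen S x' M₁ c₁ with hQ₁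
  set Q₂ := (padLinks S y').filter fun e : Edge 4 (2 * S + 1) =>
    e.1 ∉ padFrozen S y' M₂ c₂ ∧ e.1.shift e.2 ∉ padFrozen S y' M₂ c₂ with hQ₂
  have hreg₁ : IsPadRegion S x' Q₁ := by
    have := isPadRegion_forced_union x' M₁ c₁ hc₁ ∅ (Finset.empty_subset _)
    rwa [Finset.union_empty] at this
  have hreg₂ : IsPadRegion S y' Q₂ := by
    have := isPadRegion_forced_union y' M₂ c₂ hc₂ ∅ (Finset.empty_subset _)
    rwa [Finset.union_empty] at this
  refine ⟨x', y', Q₁, Q₂, hax, hby, hreg₁, hreg₂, Finset.filter_subset _ _, Finset.filter_subset _ _, ?_⟩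
  have hsa := star_subset_forced x' a M₁ c₁ hast
  have hsb := star_subset_forced y' b M₂ c₂ hbst
  have hA : ∀ w : TorusSite 4 (2 * S + 1), w ∈ (ball S z r)ᶜ ↔ w ∉ ball S z r := fun w => Finset.mem_compl
  intro χ hχ
  refine balanced_touched_of_blocks (ball S z r)ᶜ (starLinks S a ∪ starLinks S b ∪ Q₁ ∪ Q₂) P₁ P₂ σ
    ?_ ?_ ?_ ?_ ?_ ?_ ?_ χ hχ
  · intro e he
    simp only [Finset.mem_union] at he
    rcases he with ((h | h) | h) | h
    · exact Or.inl (hsa e h)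
    · exact Or.inr (hsb e h)
    · exact Or.inl ((mem_forced_iff x' M₁ c₁ e).1 h)
    · exact Or.inr ((mem_forced_iff y' M₂ c₂ e).1 h)
  · intro w μ hw hw'
    simp only [Finset.mem_union]
    exact Or.inl (Or.inr ((mem_forced_iff x' M₁ c₁ (w, μ)).2 ⟨hw, hw'⟩))
  · intro w μ hw hw'
    simp only [Finset.mem_union]
    exact Or.inr ((mem_forced_iff y' M₂ c₂ (w, μ)).2 ⟨hw, hw'⟩)
  · intro w hw hwA
    have h := hσ₁ w hw ((hA w).1 hwA)
    exact ⟨h.1, (hA _).2 h.2.1⟩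
  · intro w hw hwA
    have h := hσ₂ w hw ((hA w).1 hwA)
    exact ⟨h.1, (hA _).2 h.2.1⟩
  · intro w hw hwA
    rcases Finset.mem_union.1 hw with h | h
    · exact (hσ₁ w h ((hA w).1 hwA)).2.2.1
    · exact (hσ₂ w h ((hA w).1 hwA)).2.2.1
  · intro w hw hwA
    rcases Finset.mem_union.1 hw with h | h
    · exact (hσ₁ w h ((hA w).1 hwA)).2.2.2
    · exact (hσ₂ w h ((hA w).1 hwA)).2.2.2

/-- **Registered helper `stub_placementSides_aux4` of crux stmt-QuantumFields-17375** (line `pad-the-fibre`, stub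
`stub_placementSides`): the balanced canonical placement for the ball-complement side (first-outside-coordinate flip). [folklore] -/
theorem stub_placementSides_aux4 : ∀ (S : ℕ), 2 ≤ S → ∀ (z : TorusSite 4 (2 * S + 1)) (r : ℕ), 1 ≤ r → r + 1 ≤ S → ∀ (a b : TorusSite 4 (2 * S + 1)), ∃ (x' y' : TorusSite 4 (2 * S + 1)) (Q₁ Q₂ : Finset (Edge 4 (2 * S + 1))), a ∈ ebox S x' 0 ∧ b ∈ ebox S y' 0 ∧ IsPadRegion S x' Q₁ ∧ IsPadRegion S y' Q₂ ∧ Q₁ ⊆ padLinks S x' ∧ Q₂ ⊆ padLinks S y' ∧ Balanced (touched S (ball S z r)ᶜ (starLinks S a ∪ starLinks S b ∪ Q₁ ∪ Q₂)) :=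
  fun _ hS z r hr₁ hr₂ a b => ballc_balanced hS z r hr₁ hr₂ a b

end Summit.QuantumFields.QCD.Theorems.PadTheFibreTwoStar

end
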